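import Mathlib
import Literature.Analysis.FunctionSpaces.Mollification
import Literature.Analysis.FluidPDE.SteadyEulerVelocityTesting
import Literature.Analysis.FluidPDE.TaoEnstrophyLocalisation
import Literature.Analysis.FluidPDE.BiotSavartBounds
import HarnessLib

/-!
# Crux `EulerZoomLiouville.PowerGaugeEulerLiouville` (stmt-NavierStokesRegularity-19832), weak stratum
# `stub_selfSimilarWeakRest`: TOOLS FOR THE WEAK CONFINED-VORTICITY MEMBER — mollified weak-gradient fields and the
# `L¹` far field of the Biot–Savart law

Route №10 `EulerZoomLiouville` (NavierStokesRegularity), crux E = stmt-NavierStokesRegularity-19832; width seat ns-ezl-w1 g8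
under the LEAD ns-typeII-p2 g14 (lane: `Sig.stub_selfSimilarWeakRest` member layer).  The member theorem of the sequel file
`…WeakConfinedVorticity` kills exactly self-similar members of ANY regularity whose profile's weak gradient is a.e. symmetric
outside a ball (vorticity confined to a ball).  Its mechanism is Friedrichs regularisation: for a field `V ∈ L¹_loc(ℝ³; ℝ³)`
with whole-space weak gradient `G` (`HasWeakFDerivOn ⊤ volume V G`) and a normalised bump `φ`, the mollification
`V_φ = φ ⋆ V` is smooth with `DV_φ = φ ⋆ G` (tree `FunctionSpaces.HasWeakFDerivOn.hasFDerivAt_convolution`), hence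

* `clm_fderiv_mollify_eq_integral` — `T(DV_φ(x)) = ∫ φ(t) T(G(x − t)) dt` for every continuous linear `T` on `ℝ³ →L ℝ³`;
* `isDivFree_mollify` — `div V_φ ≡ 0` when `V` is weakly divergence free (`tr G = 0` a.e., tree
  `IsWeaklyDivFree.trace_weakGradient_ae_eq_zero`);
* `curl_mollify_eq` — if `G` is a.e. SYMMETRIC on `{‖y‖ > R₀}` then `curl V_φ = φ ⋆ (𝟙_{B̄(0,R₀)} curlCLM ∘ G)` everywhere; so
  `curl V_φ` is compactly supported in `B̄(0, R₀ + r_φ)` (`hasCompactSupport_curl_mollify`, `curl_mollify_eq_zero_of_lt_norm`) with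
  `∫‖curl V_φ‖ ≤ ∫_{B̄(0,R₀)}‖curlCLM ∘ G‖` (`integral_norm_curl_mollify_le`);
* `lintegral_ball_mollify_sq_le` — `∫_{B_L}‖V_φ‖² ≤ ∫_{B_{L+r_φ}}‖V‖²` (locality + Young with a unit-mass kernel);
* `norm_biotSavart_le_integral_norm_of_le_dist` — the `L¹` far field of the Biot–Savart law: `supp ω ⊆ B̄(x₀,R)`, `ω ∈ L¹`,
  `2R ≤ ‖x − x₀‖` ⇒ `‖(K₃ ∗ ω)(x)‖ ≤ π⁻¹ (‖x − x₀‖²)⁻¹ ∫‖ω‖` (the tree's `norm_biotSavart_le_of_le_dist` with `‖ω‖_∞|B_R|` replaced by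
  `‖ω‖₁`, which is what survives the limit `r_φ → 0`);
* `curlCLM_eq_zero_of_symm` — a symmetric Jacobian has no curl.

WHAT THIS IS NOT: not NS, not E, not the weak stub — analysis tools `--supports` stmt-19832. [folklore; Evans2010 §5.3.1 Thm. 1;
MajdaBertozziCUP2002 §2.4.1 (2.10)–(2.12), (4.30)]
-/

noncomputable section

-- flat `Theorems/<Route><Decl>…` files of one crux share the namespace of the crux (tree convention)
set_option linter.dupNamespace false

open MeasureTheory Set Filter Topology Metric Function TopologicalSpace ContinuousLinearMap
open scoped ENNReal NNReal Convolution InnerProductSpace RealInnerProductSpace ContDiff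

namespace Summit.NavierStokesRegularity.NavierStokesRegularity.Theorems.PowerGaugeEulerLiouville.WeakConfinedVorticity

open Literature.Analysis Literature.Analysis.FunctionSpaces Literature.Analysis.FluidPDE

/-! ### A symmetric Jacobian has no curl -/

/-- A symmetric linear map on `ℝ³` has zero curl vector: `curlCLM L = 0` when `⟪L v, w⟫ = ⟪L w, v⟫` for all `v, w`
(the components `(L eⱼ)ᵢ − (L eᵢ)ⱼ` vanish). [folklore] -/
theorem curlCLM_eq_zero_of_symm {L : EuclideanSpace ℝ (Fin 3) →L[ℝ] EuclideanSpace ℝ (Fin 3)}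
    (h : ∀ v w : EuclideanSpace ℝ (Fin 3), ⟪L v, w⟫ = ⟪L w, v⟫) : curlCLM L = 0 := by
  have hc : ∀ i j : Fin 3, L (EuclideanSpace.single j 1) i = L (EuclideanSpace.single i 1) j := by
    intro i j
    have h1 := h (EuclideanSpace.single j 1) (EuclideanSpace.single i 1)
    simpa [EuclideanSpace.inner_single_right] using h1
  change curlLM L = 0
  simp only [curlLM, LinearMap.coe_mk, AddHom.coe_mk]
  rw [hc 2 1, hc 0 2, hc 1 0, sub_self, sub_self, sub_self]
  ext i
  fin_cases i <;> simp

/-! ### The `L¹` far field of the Biot–Savart law -/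

/-- **`L¹` far-field bound for the Biot–Savart velocity.**  If `ω` is integrable with `supp ω ⊆ B̄(x₀, R)`, `R > 0`, and
`2R ≤ ‖x − x₀‖`, then `‖(K₃ ∗ ω)(x)‖ ≤ π⁻¹ (‖x − x₀‖²)⁻¹ ∫‖ω‖` (on the support `‖x − y‖ ≥ ‖x − x₀‖/2` and
`|K₃(z)| ≤ (4π)⁻¹|z|⁻²`). [folklore; MajdaBertozziCUP2002 §2.4.1 (4.30)] -/
theorem norm_biotSavart_le_integral_norm_of_le_dist {w : EuclideanSpace ℝ (Fin 3) → EuclideanSpace ℝ (Fin 3)}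
    {x₀ : EuclideanSpace ℝ (Fin 3)} {R : ℝ} (hR : 0 < R) (hwi : Integrable w)
    (hsupp : support w ⊆ closedBall x₀ R) {x : EuclideanSpace ℝ (Fin 3)} (hx : 2 * R ≤ ‖x - x₀‖) :
    ‖biotSavart w x‖ ≤ Real.pi⁻¹ * (‖x - x₀‖ ^ 2)⁻¹ * ∫ y, ‖w y‖ := by
  have hd : 0 < ‖x - x₀‖ := by nlinarith
  set c : ℝ := (4 * Real.pi)⁻¹ * (4 * (‖x - x₀‖ ^ 2)⁻¹) with hc
  have hc0 : 0 ≤ c := by positivity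
  have hpt : ∀ y, ‖biotSavartKernel (x - y) (w y)‖ ≤ c * ‖w y‖ := by
    intro y
    by_cases hy : y ∈ closedBall x₀ R
    · have hxy : ‖x - x₀‖ / 2 ≤ ‖x - y‖ := by
        have h1 : ‖x - x₀‖ ≤ ‖x - y‖ + ‖y - x₀‖ := norm_sub_le_norm_sub_add_norm_sub x y x₀
        rw [mem_closedBall, dist_eq_norm] at hy
        linarith
      have hinv : (‖x - y‖ ^ 2)⁻¹ ≤ 4 * (‖x - x₀‖ ^ 2)⁻¹ := by
        have hpos : 0 < (‖x - x₀‖ / 2) ^ 2 := by positivity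
        calc (‖x - y‖ ^ 2)⁻¹ ≤ ((‖x - x₀‖ / 2) ^ 2)⁻¹ :=
              inv_anti₀ hpos (pow_le_pow_left₀ (by positivity) hxy 2)
          _ = 4 * (‖x - x₀‖ ^ 2)⁻¹ := by
              field_simp
              ring
      calc ‖biotSavartKernel (x - y) (w y)‖ ≤ (4 * Real.pi)⁻¹ * ‖w y‖ * (‖x - y‖ ^ 2)⁻¹ :=
            norm_biotSavartKernel_le _ _
        _ ≤ (4 * Real.pi)⁻¹ * ‖w y‖ * (4 * (‖x - x₀‖ ^ 2)⁻¹) := by gcongr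
        _ = c * ‖w y‖ := by rw [hc]; ring
    · have hw : w y = 0 := by
        by_contra h'
        exact hy (hsupp (mem_support.2 h'))
      rw [hw, biotSavartKernel_zero_right, norm_zero, mul_zero]
  have h1 : ‖biotSavart w x‖ ≤ ∫ y, c * ‖w y‖ := by
    rw [biotSavart]
    exact norm_integral_le_of_norm_le (hwi.norm.const_mul c) (Eventually.of_forall hpt)
  rw [integral_const_mul] at h1
  calc ‖biotSavart w x‖ ≤ c * ∫ y, ‖w y‖ := h1
    _ = Real.pi⁻¹ * (‖x - x₀‖ ^ 2)⁻¹ * ∫ y, ‖w y‖ := by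
        rw [hc]
        congr 1
        field_simp

/-! ### Mollified weak-gradient fields -/

section Mollify

variable {V : EuclideanSpace ℝ (Fin 3) → EuclideanSpace ℝ (Fin 3)}
  {G : EuclideanSpace ℝ (Fin 3) → EuclideanSpace ℝ (Fin 3) →L[ℝ] EuclideanSpace ℝ (Fin 3)}

/-- Unfolding the mollification with the scalar action: `(φ ⋆ g)(x) = ∫ φ(t) • g(x − t) dt`. [folklore] -/
theorem normed_convolution_apply {F : Type*} [NormedAddCommGroup F] [NormedSpace ℝ F]
    (φ : ContDiffBump (0 : EuclideanSpace ℝ (Fin 3))) (g : EuclideanSpace ℝ (Fin 3) → F) (x : EuclideanSpace ℝ (Fin 3)) :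
    (φ.normed volume ⋆[lsmul ℝ ℝ, volume] g) x = ∫ t, φ.normed volume t • g (x - t) := by
  rw [convolution_def]
  simp only [lsmul_apply]

/-- The integrand of a mollification of a locally integrable function is integrable. [folklore] -/
theorem integrable_normed_smul_comp_sub {F : Type*} [NormedAddCommGroup F] [NormedSpace ℝ F]
    (φ : ContDiffBump (0 : EuclideanSpace ℝ (Fin 3))) {g : EuclideanSpace ℝ (Fin 3) → F}
    (hg : LocallyIntegrable g volume) (x : EuclideanSpace ℝ (Fin 3)) :
    Integrable (fun t => φ.normed volume t • g (x - t)) volume := by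
  have h := (φ.hasCompactSupport_normed (μ := volume)).convolutionExists_left (lsmul ℝ ℝ : ℝ →L[ℝ] F →L[ℝ] F)
    φ.continuous_normed hg x
  have h' : Integrable (fun t => (lsmul ℝ ℝ : ℝ →L[ℝ] F →L[ℝ] F) (φ.normed volume t) (g (x - t))) volume := h.integrable
  simpa only [lsmul_apply] using h'

/-- **`T(DV_φ(x)) = ∫ φ(t) T(G(x − t)) dt`** for every continuous linear `T` on the Jacobians: the derivative of the
mollification is the mollified weak gradient (tree `HasWeakFDerivOn.hasFDerivAt_convolution`) and `T` commutes with the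
Bochner integral. [folklore; Evans2010 §5.3.1 Thm. 1] -/
theorem clm_fderiv_mollify_eq_integral {F : Type*} [NormedAddCommGroup F] [NormedSpace ℝ F] [CompleteSpace F]
    (hw : HasWeakFDerivOn (⊤ : Opens (EuclideanSpace ℝ (Fin 3))) volume V G)
    (φ : ContDiffBump (0 : EuclideanSpace ℝ (Fin 3)))
    (T : (EuclideanSpace ℝ (Fin 3) →L[ℝ] EuclideanSpace ℝ (Fin 3)) →L[ℝ] F) (x : EuclideanSpace ℝ (Fin 3)) :
    T (fderiv ℝ (φ.normed volume ⋆[lsmul ℝ ℝ, volume] V) x) = ∫ t, φ.normed volume t • T (G (x - t)) := by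
  have hG : LocallyIntegrable G volume := locallyIntegrableOn_univ.1 (by
    simpa only [Opens.coe_top] using hw.locallyIntegrableOn_deriv)
  rw [(hw.hasFDerivAt_convolution (isTestFunctionOn_normed φ) x).fderiv, normed_convolution_apply,
    ← T.integral_comp_comm (integrable_normed_smul_comp_sub φ hG x)]
  simp only [map_smul]

/-- The mollification of a field with a whole-space weak gradient is smooth. [folklore; Evans2010 §5.3.1 Thm. 1] -/
theorem contDiff_mollify (hw : HasWeakFDerivOn (⊤ : Opens (EuclideanSpace ℝ (Fin 3))) volume V G)
    (φ : ContDiffBump (0 : EuclideanSpace ℝ (Fin 3))) :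
    ContDiff ℝ ∞ (φ.normed volume ⋆[lsmul ℝ ℝ, volume] V) :=
  hw.contDiff_convolution (isTestFunctionOn_normed φ)

/-- A null set stays null under `t ↦ x − t`: an a.e. property of `y` holds for a.e. `t` at `y = x − t`. [folklore] -/
theorem ae_comp_sub_left {p : EuclideanSpace ℝ (Fin 3) → Prop} (h : ∀ᵐ y ∂(volume : Measure (EuclideanSpace ℝ (Fin 3))), p y)
    (x : EuclideanSpace ℝ (Fin 3)) :
    ∀ᵐ t ∂(volume : Measure (EuclideanSpace ℝ (Fin 3))), p (x - t) :=
  (quasiMeasurePreserving_sub_left volume x).ae h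

/-- **Mollification preserves weak incompressibility, classically**: if `V` is weakly divergence free with whole-space
weak gradient `G`, then `div (φ ⋆ V) ≡ 0` (`tr G = 0` a.e., tree `IsWeaklyDivFree.trace_weakGradient_ae_eq_zero`, and
`tr` commutes with the mollification integral). [folklore; Evans2010 §5.3.1 Thm. 1] -/
theorem isDivFree_mollify (hw : HasWeakFDerivOn (⊤ : Opens (EuclideanSpace ℝ (Fin 3))) volume V G)
    (hdiv : IsWeaklyDivFree V) (φ : ContDiffBump (0 : EuclideanSpace ℝ (Fin 3))) :
    VectorCalculus.IsDivFree (φ.normed volume ⋆[lsmul ℝ ℝ, volume] V) := by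
  intro x
  -- the trace as a continuous linear functional on the Jacobians
  set T : (EuclideanSpace ℝ (Fin 3) →L[ℝ] EuclideanSpace ℝ (Fin 3)) →L[ℝ] ℝ :=
    LinearMap.toContinuousLinearMap
      ((LinearMap.trace ℝ (EuclideanSpace ℝ (Fin 3))) ∘ₗ
        (ContinuousLinearMap.coeLM ℝ : (EuclideanSpace ℝ (Fin 3) →L[ℝ] EuclideanSpace ℝ (Fin 3)) →ₗ[ℝ]
          (EuclideanSpace ℝ (Fin 3) →ₗ[ℝ] EuclideanSpace ℝ (Fin 3)))) with hT
  have hTapp : ∀ M : EuclideanSpace ℝ (Fin 3) →L[ℝ] EuclideanSpace ℝ (Fin 3),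
      T M = LinearMap.trace ℝ (EuclideanSpace ℝ (Fin 3)) (M : EuclideanSpace ℝ (Fin 3) →ₗ[ℝ] EuclideanSpace ℝ (Fin 3)) :=
    fun M => rfl
  have htr := hdiv.trace_weakGradient_ae_eq_zero hw
  unfold VectorCalculus.divergence
  rw [← hTapp, clm_fderiv_mollify_eq_integral hw φ T x]
  refine integral_eq_zero_of_ae ?_
  filter_upwards [ae_comp_sub_left htr x] with t ht
  rw [hTapp, ht, smul_zero]
  rfl

/-- The confined curl density `𝟙_{B̄(0,R₀)} · curlCLM ∘ G` of a weak gradient `G`. (Local abbreviation-free: we write the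
indicator explicitly in every statement.) Its integrability: `G ∈ L¹_loc`. [folklore] -/
theorem integrable_indicator_curlCLM (hw : HasWeakFDerivOn (⊤ : Opens (EuclideanSpace ℝ (Fin 3))) volume V G) (R₀ : ℝ) :
    Integrable ((closedBall (0 : EuclideanSpace ℝ (Fin 3)) R₀).indicator fun y => curlCLM (G y)) volume := by
  have hG : LocallyIntegrable G volume := locallyIntegrableOn_univ.1 (by
    simpa only [Opens.coe_top] using hw.locallyIntegrableOn_deriv)
  have h1 : IntegrableOn (fun y => curlCLM (G y)) (closedBall (0 : EuclideanSpace ℝ (Fin 3)) R₀) volume :=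
    (curlCLM.integrable_comp (hG.integrableOn_isCompact (isCompact_closedBall _ _)))
  exact h1.integrable_indicator measurableSet_closedBall

/-- **The curl of the mollification is the mollified confined curl density**: if the weak gradient `G` of `V` is a.e.
symmetric on `{‖y‖ > R₀}`, then for every `x`, `curl (φ ⋆ V)(x) = ∫ φ(t) • (𝟙_{B̄(0,R₀)} curlCLM ∘ G)(x − t) dt`, i.e.
`curl V_φ = φ ⋆ (𝟙_{B̄(0,R₀)} curlCLM ∘ G)`. [folklore] -/
theorem curl_mollify_eq (hw : HasWeakFDerivOn (⊤ : Opens (EuclideanSpace ℝ (Fin 3))) volume V G) {R₀ : ℝ}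
    (hsymm : ∀ᵐ y ∂(volume : Measure (EuclideanSpace ℝ (Fin 3))), R₀ < ‖y‖ →
      ∀ v w : EuclideanSpace ℝ (Fin 3), ⟪G y v, w⟫ = ⟪G y w, v⟫)
    (φ : ContDiffBump (0 : EuclideanSpace ℝ (Fin 3))) :
    curl (φ.normed volume ⋆[lsmul ℝ ℝ, volume] V) =
      φ.normed volume ⋆[lsmul ℝ ℝ, volume] ((closedBall (0 : EuclideanSpace ℝ (Fin 3)) R₀).indicator fun y => curlCLM (G y)) := by
  funext x
  rw [curl_eq_curlCLM, clm_fderiv_mollify_eq_integral hw φ curlCLM x, normed_convolution_apply]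
  refine integral_congr_ae ?_
  filter_upwards [ae_comp_sub_left hsymm x] with t ht
  by_cases hmem : x - t ∈ closedBall (0 : EuclideanSpace ℝ (Fin 3)) R₀
  · rw [indicator_of_mem hmem]
  · rw [indicator_of_notMem hmem, smul_zero]
    have hfar : R₀ < ‖x - t‖ := by
      rw [mem_closedBall, dist_zero_right, not_le] at hmem
      exact hmem
    rw [curlCLM_eq_zero_of_symm (ht hfar), smul_zero]

/-- Hence `curl (φ ⋆ V)` has compact support (both convolution factors do). [folklore] -/
theorem hasCompactSupport_curl_mollify (hw : HasWeakFDerivOn (⊤ : Opens (EuclideanSpace ℝ (Fin 3))) volume V G) {R₀ : ℝ}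
    (hsymm : ∀ᵐ y ∂(volume : Measure (EuclideanSpace ℝ (Fin 3))), R₀ < ‖y‖ →
      ∀ v w : EuclideanSpace ℝ (Fin 3), ⟪G y v, w⟫ = ⟪G y w, v⟫)
    (φ : ContDiffBump (0 : EuclideanSpace ℝ (Fin 3))) :
    HasCompactSupport (curl (φ.normed volume ⋆[lsmul ℝ ℝ, volume] V)) := by
  rw [curl_mollify_eq hw hsymm φ]
  refine (φ.hasCompactSupport_normed (μ := volume)).convolution _ ?_
  exact HasCompactSupport.intro (isCompact_closedBall (0 : EuclideanSpace ℝ (Fin 3)) R₀)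
    (fun y hy => indicator_of_notMem hy _)

/-- … and `curl (φ ⋆ V)(x) = 0` as soon as `‖x‖ > R₀ + r_φ` (the bump at `x` does not see the ball `B̄(0,R₀)`). [folklore] -/
theorem curl_mollify_eq_zero_of_lt_norm (hw : HasWeakFDerivOn (⊤ : Opens (EuclideanSpace ℝ (Fin 3))) volume V G) {R₀ : ℝ}
    (hsymm : ∀ᵐ y ∂(volume : Measure (EuclideanSpace ℝ (Fin 3))), R₀ < ‖y‖ →
      ∀ v w : EuclideanSpace ℝ (Fin 3), ⟪G y v, w⟫ = ⟪G y w, v⟫)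
    (φ : ContDiffBump (0 : EuclideanSpace ℝ (Fin 3))) {x : EuclideanSpace ℝ (Fin 3)} (hx : R₀ + φ.rOut < ‖x‖) :
    curl (φ.normed volume ⋆[lsmul ℝ ℝ, volume] V) x = 0 := by
  rw [curl_mollify_eq hw hsymm φ, normed_convolution_apply]
  refine integral_eq_zero_of_ae (Eventually.of_forall fun t => ?_)
  by_cases ht : t ∈ ball (0 : EuclideanSpace ℝ (Fin 3)) φ.rOut
  · have hfar : x - t ∉ closedBall (0 : EuclideanSpace ℝ (Fin 3)) R₀ := by
      rw [mem_closedBall, dist_zero_right, not_le]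
      rw [mem_ball, dist_zero_right] at ht
      have h1 : ‖x‖ ≤ ‖x - t‖ + ‖t‖ := norm_le_norm_sub_add x t
      linarith
    simp only [indicator_of_notMem hfar, smul_zero, Pi.zero_apply]
  · have h0 : φ.normed volume t = 0 := by
      have : t ∉ support (φ.normed volume) := by rwa [φ.support_normed_eq]
      simpa [mem_support] using this
    simp only [h0, zero_smul, Pi.zero_apply]

/-- The support of `curl (φ ⋆ V)` lies in the closed ball `B̄(0, R₀ + r_φ)`. [folklore] -/
theorem support_curl_mollify_subset (hw : HasWeakFDerivOn (⊤ : Opens (EuclideanSpace ℝ (Fin 3))) volume V G) {R₀ : ℝ}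
    (hsymm : ∀ᵐ y ∂(volume : Measure (EuclideanSpace ℝ (Fin 3))), R₀ < ‖y‖ →
      ∀ v w : EuclideanSpace ℝ (Fin 3), ⟪G y v, w⟫ = ⟪G y w, v⟫)
    (φ : ContDiffBump (0 : EuclideanSpace ℝ (Fin 3))) :
    support (curl (φ.normed volume ⋆[lsmul ℝ ℝ, volume] V)) ⊆ closedBall (0 : EuclideanSpace ℝ (Fin 3)) (R₀ + φ.rOut) := by
  intro x hx
  rw [mem_closedBall, dist_zero_right]
  by_contra h
  exact hx (curl_mollify_eq_zero_of_lt_norm hw hsymm φ (not_le.mp h))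

/-- **`‖curl (φ ⋆ V)‖_{L¹} ≤ ‖curlCLM ∘ G‖_{L¹(B̄(0,R₀))}`**, uniformly in the bump (Young's inequality with a unit-mass kernel,
tree `eLpNorm_normed_convolution_le` at `p = 1`). [folklore; Evans2010 App. C.4 Thm. 7] -/
theorem integral_norm_curl_mollify_le (hw : HasWeakFDerivOn (⊤ : Opens (EuclideanSpace ℝ (Fin 3))) volume V G) {R₀ : ℝ}
    (hsymm : ∀ᵐ y ∂(volume : Measure (EuclideanSpace ℝ (Fin 3))), R₀ < ‖y‖ →
      ∀ v w : EuclideanSpace ℝ (Fin 3), ⟪G y v, w⟫ = ⟪G y w, v⟫)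
    (φ : ContDiffBump (0 : EuclideanSpace ℝ (Fin 3))) :
    Integrable (curl (φ.normed volume ⋆[lsmul ℝ ℝ, volume] V)) volume ∧
      ∫ x, ‖curl (φ.normed volume ⋆[lsmul ℝ ℝ, volume] V) x‖ ≤
        ∫ y, ‖(closedBall (0 : EuclideanSpace ℝ (Fin 3)) R₀).indicator (fun y => curlCLM (G y)) y‖ := by
  set cG := (closedBall (0 : EuclideanSpace ℝ (Fin 3)) R₀).indicator fun y => curlCLM (G y) with hcG
  have hcGi : Integrable cG volume := integrable_indicator_curlCLM hw R₀
  have heq := curl_mollify_eq hw hsymm φ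
  have hint : Integrable (φ.normed volume ⋆[lsmul ℝ ℝ, volume] cG) volume :=
    (φ.integrable_normed (μ := volume)).integrable_convolution (lsmul ℝ ℝ) hcGi
  refine ⟨by rw [heq]; exact hint, ?_⟩
  have hY := eLpNorm_normed_convolution_le φ (h := cG) hcGi.aestronglyMeasurable (p := 1) le_rfl
  rw [heq]
  have h1 : ∫ x, ‖(φ.normed volume ⋆[lsmul ℝ ℝ, volume] cG) x‖ = (eLpNorm (φ.normed volume ⋆[lsmul ℝ ℝ, volume] cG) 1 volume).toReal := by
    rw [integral_norm_eq_lintegral_enorm hint.aestronglyMeasurable, eLpNorm_one_eq_lintegral_enorm]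
  have h2 : ∫ y, ‖cG y‖ = (eLpNorm cG 1 volume).toReal := by
    rw [integral_norm_eq_lintegral_enorm hcGi.aestronglyMeasurable, eLpNorm_one_eq_lintegral_enorm]
  rw [h1, h2]
  exact ENNReal.toReal_mono (memLp_one_iff_integrable.2 hcGi).eLpNorm_lt_top.ne hY

/-- **Locality + Young: `∫_{B_L}‖φ ⋆ V‖² ≤ ∫_{B_{L + r_φ}}‖V‖²`.**  On `B(0,L)` the mollification only sees `V` on `B(0, L + r_φ)`,
so it agrees there with `φ ⋆ (𝟙_{B(0,L+r_φ)} V)`, whose `L²` norm is at most that of `𝟙_{B(0,L+r_φ)} V` (unit-mass kernel).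
[folklore; Evans2010 App. C.4 Thm. 7] -/
theorem lintegral_ball_mollify_sq_le (hVm : AEStronglyMeasurable V volume)
    (φ : ContDiffBump (0 : EuclideanSpace ℝ (Fin 3))) (L : ℝ) :
    ∫⁻ y in ball (0 : EuclideanSpace ℝ (Fin 3)) L, ‖(φ.normed volume ⋆[lsmul ℝ ℝ, volume] V) y‖ₑ ^ 2 ≤
      ∫⁻ y in ball (0 : EuclideanSpace ℝ (Fin 3)) (L + φ.rOut), ‖V y‖ₑ ^ 2 := by
  set V' := (ball (0 : EuclideanSpace ℝ (Fin 3)) (L + φ.rOut)).indicator V with hV'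
  have hV'm : AEStronglyMeasurable V' volume := hVm.indicator measurableSet_ball
  -- locality: on `B(0,L)` the two mollifications agree
  have hloc : ∀ y ∈ ball (0 : EuclideanSpace ℝ (Fin 3)) L,
      (φ.normed volume ⋆[lsmul ℝ ℝ, volume] V) y = (φ.normed volume ⋆[lsmul ℝ ℝ, volume] V') y := by
    intro y hy
    rw [normed_convolution_apply, normed_convolution_apply]
    refine integral_congr_ae (Eventually.of_forall fun t => ?_)
    by_cases ht : t ∈ ball (0 : EuclideanSpace ℝ (Fin 3)) φ.rOut
    · have hmem : y - t ∈ ball (0 : EuclideanSpace ℝ (Fin 3)) (L + φ.rOut) := by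
        rw [mem_ball, dist_zero_right] at hy ht ⊢
        exact lt_of_le_of_lt (norm_sub_le y t) (by linarith)
      simp only [hV', indicator_of_mem hmem]
    · have h0 : φ.normed volume t = 0 := by
        have : t ∉ support (φ.normed volume) := by rwa [φ.support_normed_eq]
        simpa [mem_support] using this
      simp only [h0, zero_smul]
  -- Young at `p = 2`
  have hY := eLpNorm_normed_convolution_le φ (h := V') hV'm (p := 2) one_le_two
  have hY2 : eLpNorm (φ.normed volume ⋆[lsmul ℝ ℝ, volume] V') 2 volume ^ ((2 : ℝ≥0) : ℝ) ≤
      eLpNorm V' 2 volume ^ ((2 : ℝ≥0) : ℝ) := ENNReal.rpow_le_rpow hY (by norm_num)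
  have e1 : eLpNorm (φ.normed volume ⋆[lsmul ℝ ℝ, volume] V') 2 volume ^ ((2 : ℝ≥0) : ℝ) =
      ∫⁻ y, ‖(φ.normed volume ⋆[lsmul ℝ ℝ, volume] V') y‖ₑ ^ 2 := by
    have := eLpNorm_nnreal_pow_eq_lintegral (f := φ.normed volume ⋆[lsmul ℝ ℝ, volume] V') (μ := volume)
      (p := (2 : ℝ≥0)) two_ne_zero
    rw [ENNReal.coe_ofNat] at this
    rw [this]
    refine lintegral_congr fun y => ?_
    rw [NNReal.coe_ofNat, ENNReal.rpow_two]
  have e2 : eLpNorm V' 2 volume ^ ((2 : ℝ≥0) : ℝ) = ∫⁻ y, ‖V' y‖ₑ ^ 2 := by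
    have := eLpNorm_nnreal_pow_eq_lintegral (f := V') (μ := volume) (p := (2 : ℝ≥0)) two_ne_zero
    rw [ENNReal.coe_ofNat] at this
    rw [this]
    refine lintegral_congr fun y => ?_
    rw [NNReal.coe_ofNat, ENNReal.rpow_two]
  rw [e1, e2] at hY2
  -- `∫⁻ ‖V'‖² = ∫⁻_{B(0,L+r)} ‖V‖²`
  have e3 : ∫⁻ y, ‖V' y‖ₑ ^ 2 = ∫⁻ y in ball (0 : EuclideanSpace ℝ (Fin 3)) (L + φ.rOut), ‖V y‖ₑ ^ 2 := by
    rw [← lintegral_indicator measurableSet_ball]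
    refine lintegral_congr fun y => ?_
    by_cases hy : y ∈ ball (0 : EuclideanSpace ℝ (Fin 3)) (L + φ.rOut)
    · simp only [hV', indicator_of_mem hy]
    · simp only [hV', indicator_of_notMem hy, enorm_zero, ne_eq, OfNat.ofNat_ne_zero, not_false_eq_true, zero_pow]
  rw [e3] at hY2
  calc ∫⁻ y in ball (0 : EuclideanSpace ℝ (Fin 3)) L, ‖(φ.normed volume ⋆[lsmul ℝ ℝ, volume] V) y‖ₑ ^ 2
      = ∫⁻ y in ball (0 : EuclideanSpace ℝ (Fin 3)) L, ‖(φ.normed volume ⋆[lsmul ℝ ℝ, volume] V') y‖ₑ ^ 2 :=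
        setLIntegral_congr_fun measurableSet_ball (fun y hy => by rw [hloc y hy])
    _ ≤ ∫⁻ y, ‖(φ.normed volume ⋆[lsmul ℝ ℝ, volume] V') y‖ₑ ^ 2 := setLIntegral_le_lintegral _ _
    _ ≤ _ := hY2

end Mollify

end Summit.NavierStokesRegularity.NavierStokesRegularity.Theorems.PowerGaugeEulerLiouville.WeakConfinedVorticity

end
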